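import Literature.MathematicalPhysics.QuantumLattice.FockRelabel
import Literature.MathematicalPhysics.QuantumLattice.PairChirality

/-!
# Route `CooperPairDMottWalk`, crux `BindingWalk` (stmt-HubbardSuperconductivity-1176):
# transition amplitudes under lattice symmetries (generic lemmas)

Helper file (`--supports stmt-HubbardSuperconductivity-1176`) for the registered line
`Cruxes/BindingWalk/Lines/birth.lean`; the generic half of the proof that the route's Cooper-pair
package is false on the `4 × 4` torus (`CooperPairDMottWalkBindingWalkNoPackageOnFour`):

* `relabel_mapEquiv_bond`, `relabel_mapEquiv_sum_bond` — the singlet bond pair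
  `bond u v = c_{u↑}c_{v↓} - c_{u↓}c_{v↑}` and its sums over sets of ordered site pairs under the
  Bogoliubov automorphism of a site bijection;
* `dotProduct_mulVec_eq_of_fockRelabel_eigen` (registered sub-goal stub; binder form
  `dotProduct_mulVec_eq_of_fockRelabel_eigen'`) — **transformation law of a transition amplitude**:
  if `U_π φ₀ = lam φ₀` and `U_π φ₂ = mu φ₂` for the Fock unitary of an orbital permutation `π`, then
  `⟨φ₂, X φ₀⟩ = (star mu · lam) ⟨φ₂, (relabel π X) φ₀⟩` for every operator `X`;
* `dWave_combination_eq_zero` — Schur's lemma by hand: four amplitudes transforming by scalars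
  under the transpositions `(2 3)`, `(1 4)`, `(1 2)` of their indices have vanishing
  `B₁`-combination `F₁ + F₂ - F₃ - F₄` (no `S₄`-eigenfunctional on the standard representation).

References: O. Bratteli, D. W. Robinson, *Operator Algebras and Quantum Statistical Mechanics II*
(1997) §5.2.2 (implementing unitaries); D. J. Scalapino, Phys. Rep. 250 (1995) 329, §2; E. P.
Wigner, *Group Theory* (1959) ch. 12. Elementary; no definition and no named fact is introduced.
-/

set_option linter.dupNamespace false

noncomputable section

namespace Summit.HubbardSuperconductivity.HubbardSuperconductivity.Theorems.CooperPairDMottWalk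

open Matrix Finset Literature.MathematicalPhysics.QuantumLattice
open Literature.MathematicalPhysics.QuantumLattice.PairChirality (bond)

/-! ### Generic: bonds under site bijections; transition amplitudes under symmetries -/

section Generic

variable {Λ Λ' : Type*} [LinearOrder Λ] [Fintype Λ] [LinearOrder Λ'] [Fintype Λ']

/-- `Γ_f b_{uv} Γ_f⁻¹ = b_{f u, f v}` for the singlet bond pair `bond u v = c_{u↑}c_{v↓} - c_{u↓}c_{v↑}`.
[cite: Scalapino1995, §2 eq. (2.2)] -/
theorem relabel_mapEquiv_bond (f : Λ ≃ Λ') (u v : Λ) :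
    relabel (Orb.mapEquiv f) (bond u v) = bond (f u) (f v) := by
  rw [bond, bond, map_sub, map_mul, map_mul, relabel_annihilation, relabel_annihilation,
    relabel_annihilation, relabel_annihilation, Orb.mapEquiv_orb, Orb.mapEquiv_orb,
    Orb.mapEquiv_orb, Orb.mapEquiv_orb]

/-- A sum of bond pairs over a set `S` of ordered site pairs is carried by `Γ_f` to the sum over
the image set `(f × f)(S)`. [folklore] -/
theorem relabel_mapEquiv_sum_bond (f : Equiv.Perm Λ) (S : Finset (Λ × Λ)) :
    relabel (Orb.mapEquiv f) (∑ p ∈ S, bond (Prod.fst p) (Prod.snd p)) =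
      ∑ p ∈ S.map (f.prodCongr f).toEmbedding, bond (Prod.fst p) (Prod.snd p) := by
  rw [map_sum, Finset.sum_map]
  refine Finset.sum_congr rfl fun p _ => ?_
  rw [relabel_mapEquiv_bond]
  rfl

/-- **Transformation law of a transition amplitude under a symmetry.** If `U_π φ₀ = lam φ₀` and
`U_π φ₂ = mu φ₂` for the Fock unitary `U_π` of an orbital permutation `π`, then for every operator
`X`: `⟨φ₂, X φ₀⟩ = (star mu · lam) ⟨φ₂, (relabel π X) φ₀⟩` (`U_π` is isometric and
`U_π X = (relabel π X) U_π`). [folklore] -/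
theorem dotProduct_mulVec_eq_of_fockRelabel_eigen' (π : Equiv.Perm (Orb Λ))
    (X : Matrix (Finset (Orb Λ)) (Finset (Orb Λ)) ℂ) {φ₀ φ₂ : Fock (Orb Λ)} {lam mu : ℂ}
    (h₀ : (fockRelabel π).val *ᵥ φ₀ = lam • φ₀) (h₂ : (fockRelabel π).val *ᵥ φ₂ = mu • φ₂) :
    star φ₂ ⬝ᵥ (X *ᵥ φ₀) = (star mu * lam) * (star φ₂ ⬝ᵥ (relabel π X *ᵥ φ₀)) := by
  have hiso : ∀ x y : Fock (Orb Λ),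
      star ((fockRelabel π).val *ᵥ x) ⬝ᵥ ((fockRelabel π).val *ᵥ y) = star x ⬝ᵥ y := by
    intro x y
    rw [star_mulVec, dotProduct_mulVec, vecMul_vecMul, fockRelabel_val,
      fockRelabel_conjTranspose_mul_self, vecMul_one]
  have hW : (fockRelabel π).val * X = relabel π X * (fockRelabel π).val :=
    fockRelabel_mul_eq_of_conj_eq π (relabel_eq_fockRelabel_conj π X).symm
  calc star φ₂ ⬝ᵥ (X *ᵥ φ₀)
      = star ((fockRelabel π).val *ᵥ φ₂) ⬝ᵥ ((fockRelabel π).val *ᵥ (X *ᵥ φ₀)) := (hiso _ _).symm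
    _ = star (mu • φ₂) ⬝ᵥ (relabel π X *ᵥ (lam • φ₀)) := by
        rw [h₂, mulVec_mulVec, hW, ← mulVec_mulVec, h₀]
    _ = (star mu * lam) * (star φ₂ ⬝ᵥ (relabel π X *ᵥ φ₀)) := by
        rw [star_smul, mulVec_smul, smul_dotProduct, dotProduct_smul, smul_eq_mul, smul_eq_mul,
          mul_assoc]

omit [LinearOrder Λ] [Fintype Λ] in
/-- **Schur by hand.** Four amplitudes `F₁,…,F₄` that transform by scalars under the transpositions
`(2 3)`, `(1 4)`, `(1 2)` of their indices have vanishing `B₁`-combination `F₁ + F₂ - F₃ - F₄`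
(no nonzero `S₄`-eigenfunctional on the standard representation). [folklore] -/
theorem dWave_combination_eq_zero {F₁ F₂ F₃ F₄ κa κb κc : ℂ}
    (a1 : F₁ = κa * F₁) (a4 : F₄ = κa * F₄) (a2 : F₂ = κa * F₃) (a3 : F₃ = κa * F₂)
    (b2 : F₂ = κb * F₂) (b1 : F₁ = κb * F₄) (b4 : F₄ = κb * F₁)
    (c1 : F₁ = κc * F₂) (c2 : F₂ = κc * F₁) :
    F₁ + F₂ - F₃ - F₄ = 0 := by
  -- `F = κ F` forces `κ = 1` or `F = 0`
  have fix : ∀ {F κ : ℂ}, F = κ * F → κ ≠ 1 → F = 0 := by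
    intro F κ h hκ
    have h' : (1 - κ) * F = 0 := by rw [sub_mul, one_mul, sub_eq_zero]; exact h
    rcases mul_eq_zero.1 h' with h1 | h1
    · exact absurd (sub_eq_zero.1 h1).symm hκ
    · exact h1
  by_cases ha : κa = 1
  · subst ha
    rw [one_mul] at a2
    by_cases hb : κb = 1
    · subst hb
      rw [one_mul] at b1
      rw [a2, b1]; ring
    · have hF2 : F₂ = 0 := fix b2 hb
      have hF3 : F₃ = 0 := by rw [← a2, hF2]
      have hF1 : F₁ = 0 := by rw [c1, hF2, mul_zero]
      have hF4 : F₄ = 0 := by rw [b4, hF1, mul_zero]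
      rw [hF1, hF2, hF3, hF4]; ring
  · have hF1 : F₁ = 0 := fix a1 ha
    have hF4 : F₄ = 0 := fix a4 ha
    have hF2 : F₂ = 0 := by rw [c2, hF1, mul_zero]
    have hF3 : F₃ = 0 := by rw [a3, hF2, mul_zero]
    rw [hF1, hF2, hF3, hF4]; ring

end Generic

/-! ### The registered sub-goal stub (verbatim signature) -/

/-- **Registered sub-goal stub `dotProduct_mulVec_eq_of_fockRelabel_eigen`** (transformation law of
a transition amplitude under a Fock relabelling symmetry; binder form
`dotProduct_mulVec_eq_of_fockRelabel_eigen'`). [folklore] -/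
theorem dotProduct_mulVec_eq_of_fockRelabel_eigen : ∀ {Λ : Type*} [LinearOrder Λ] [Fintype Λ] (π : Equiv.Perm (Orb Λ)) (X : Matrix (Finset (Orb Λ)) (Finset (Orb Λ)) ℂ) {φ₀ φ₂ : Fock (Orb Λ)} {lam mu : ℂ}, (fockRelabel π).val *ᵥ φ₀ = lam • φ₀ → (fockRelabel π).val *ᵥ φ₂ = mu • φ₂ → star φ₂ ⬝ᵥ (X *ᵥ φ₀) = (star mu * lam) * (star φ₂ ⬝ᵥ (relabel π X *ᵥ φ₀)) :=
  @fun _ _ _ π X _ _ _ _ h₀ h₂ => dotProduct_mulVec_eq_of_fockRelabel_eigen' π X h₀ h₂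

end Summit.HubbardSuperconductivity.HubbardSuperconductivity.Theorems.CooperPairDMottWalk

end
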